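import Mathlib
import Summits.ValiantsHypothesis.ValiantsHypothesis.Theorems.LacunarySymmetroidMatrixDescartesLoewnerSector

/-!
# `MatrixDescartes` (stmt-ValiantsHypothesis-18050) — REGIME WINDOWS: at most `m` positive zeros per scale window on
# which the pencil is positively normalisable to a Loewner-monotone family; the TWO-WINDOW bound `Z₊ ≤ 2m`

HONEST FRAMING.  Cell `pub-symmetroid`, seat `val-sym-mdr-p2` (gen 4); helper file `--supports` the crux
`Theses.LacunarySymmetroid.MatrixDescartes`.  An ENGINE for sector theorems (root-counting tool); nothing here bears on
the crux in general, on the line `Lift`'s open stub `stub_twoSided`, on `DoorA26` / `DoorA34`, or on `VP ≠ VNP`.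

THE PRINCIPLE.  `…LoewnerSector` proved: if ONE positive weight `w` makes `F/w` (`F = ∑ₗ X^{dₗ} Sₗ`, real symmetric
letters) Loewner non-decreasing on all of `(0,∞)`, then `Z₊ ≤ card ι`.  Here the same is proved PER WINDOW
(`RegimeWindows.posRoots_window_le`): if `F/w` is Loewner non-decreasing on an order-connected window `I ⊆ (0,∞)`, then
`det F` has at most `card ι` distinct zeros in (a designated part of) `I`.  Proof: kernel data on the window
(`RegimeWindows.kernelData_on` — at a root `t₀ ∈ I` with kernel vector `v`, a vanishing form `vᵀ(F/w)(s)v = 0` at a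
later `s ∈ I` would pin `det F = 0` on `[t₀, s]`), then the tree's inertia chain `stub_inertiaChain` applied to the
family CLAMPED to the window (`u ↦ (F/w)(π u)`, `π` a monotone retraction of `(0,∞)` onto `I` fixing the designated
roots), which is globally monotone.  Consequently
**`Z₊ ≤ card ι × (number of windows covering (0,∞) on each of which F is positively normalisable to a monotone family)`**
— a format-level bound from MAGNITUDE structure (a window is a range of scales on which, after normalisation, one
signed block of letters dominates), the Loewner-side counterpart of the cell's regime/window calculus.  This file lands
the two-window case `twoWindows_posRoots_le`: `F/w₁` non-INCREASING on `(0, x₁]` and `F/w₂` non-DEcreasing on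
`[x₁, ∞)` ⇒ `Z₊ ≤ 2·card ι` (roots in `(0,x₁)` via the left window applied to `−F`, roots in `[x₁,∞)` via the right
window).  First format family using it: the DOMINANT-MIDDLE law (`…DominantMiddle`, two sign alternations with a
dominant negative block ⇒ `2·card ι`, the Cameron–Psarrakos count `n·α` at `α = 2` — false unconditionally by the
tree's `cameronPsarrakos_counterexample`, restored under dominance).
[folklore] Elementary; Mathlib + tree lemmas (`stub_inertiaChain`, `ChainSector.eval_det_pencil`,
`LoewnerSector.smul_family_isSymm`, `roots_det_pencil_neg`); axioms `propext`, `Classical.choice`, `Quot.sound`.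
-/

-- layout Summits/ValiantsHypothesis/ValiantsHypothesis forces the duplicated namespace component
set_option linter.dupNamespace false

namespace Summit.ValiantsHypothesis.ValiantsHypothesis.Theorems.LacunarySymmetroidMatrixDescartes

open Polynomial Matrix Finset
open scoped BigOperators

namespace RegimeWindows

variable {K : ℕ} {ι : Type*} [Fintype ι]

omit [Fintype ι] in
/-- Negating the letters negates the evaluated pencil. [folklore] -/
theorem pencil_neg (d : Fin K → ℕ) (S : Fin K → Matrix ι ι ℝ) (u : ℝ) :
    ∑ l, (u ^ d l) • (-S l) = -(∑ l, (u ^ d l) • S l) := by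
  rw [← Finset.sum_neg_distrib]
  exact Finset.sum_congr rfl fun l _ => smul_neg _ _

/-- **Kernel data on a window.**  Let `I ⊆ (0,∞)` be order-connected and `w > 0` on `I` with
`u ↦ w(u)⁻¹ • F(u)` Loewner non-decreasing on `I`, `det F ≠ 0`.  At a root `t₀ ∈ I` of `det F` there is `v ≠ 0` with
`(F/w)(t₀)v = 0` and `vᵀ(F/w)(s)v > 0` for every later `s ∈ I`. [folklore] -/
theorem kernelData_on [DecidableEq ι] (d : Fin K → ℕ) (S : Fin K → Matrix ι ι ℝ) (w : ℝ → ℝ)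
    (I : Set ℝ) (hI : I.OrdConnected) (hw : ∀ u ∈ I, 0 < w u)
    (hmono : ∀ s t : ℝ, s ∈ I → t ∈ I → s ≤ t →
      (((w t)⁻¹ • ∑ l, (t ^ d l) • S l) - ((w s)⁻¹ • ∑ l, (s ^ d l) • S l)).PosSemidef)
    (hdet : Matrix.det (∑ l, ((Polynomial.X : Polynomial ℝ) ^ d l) • (S l).map Polynomial.C) ≠ 0)
    (t₀ : ℝ) (ht₀ : t₀ ∈ I)
    (hroot : (Matrix.det (∑ l, ((Polynomial.X : Polynomial ℝ) ^ d l) •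
      (S l).map Polynomial.C)).IsRoot t₀) :
    ∃ v : ι → ℝ, v ≠ 0 ∧ ((w t₀)⁻¹ • ∑ l, (t₀ ^ d l) • S l) *ᵥ v = 0 ∧
      ∀ s ∈ I, t₀ < s → 0 < v ⬝ᵥ (((w s)⁻¹ • ∑ l, (s ^ d l) • S l) *ᵥ v) := by
  have hdet0 : (∑ l, (t₀ ^ d l) • S l).det = 0 := by
    have h1 : (Matrix.det (∑ l, ((Polynomial.X : Polynomial ℝ) ^ d l) •
        (S l).map Polynomial.C)).eval t₀ = 0 := hroot
    rwa [ChainSector.eval_det_pencil d S t₀] at h1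
  obtain ⟨v, hv, hFv⟩ := Matrix.exists_mulVec_eq_zero_iff.2 hdet0
  have hGv : ((w t₀)⁻¹ • ∑ l, (t₀ ^ d l) • S l) *ᵥ v = 0 := by
    rw [Matrix.smul_mulVec, hFv, smul_zero]
  refine ⟨v, hv, hGv, fun s hsI hs => ?_⟩
  have hform_nonneg : ∀ u ∈ I, t₀ ≤ u → 0 ≤ v ⬝ᵥ (((w u)⁻¹ • ∑ l, (u ^ d l) • S l) *ᵥ v) := by
    intro u huI hu
    have h := (hmono t₀ u ht₀ huI hu).dotProduct_mulVec_nonneg v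
    rwa [star_trivial, Matrix.sub_mulVec, dotProduct_sub, hGv, dotProduct_zero, sub_zero] at h
  refine (hform_nonneg s hsI hs.le).lt_of_ne fun hzero => ?_
  have hIcc : Set.Icc t₀ s ⊆ I := hI.out ht₀ hsI
  -- the form vanishes on `[t₀, s]`, and the PSD differences kill `v` there
  have hGu : ∀ u, t₀ ≤ u → u ≤ s → ((w u)⁻¹ • ∑ l, (u ^ d l) • S l) *ᵥ v = 0 := by
    intro u hu hus
    have huI : u ∈ I := hIcc ⟨hu, hus⟩
    have hle : v ⬝ᵥ (((w u)⁻¹ • ∑ l, (u ^ d l) • S l) *ᵥ v)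
        ≤ v ⬝ᵥ (((w s)⁻¹ • ∑ l, (s ^ d l) • S l) *ᵥ v) := by
      have h := (hmono u s huI hsI hus).dotProduct_mulVec_nonneg v
      rw [star_trivial, Matrix.sub_mulVec, dotProduct_sub] at h
      linarith
    have hformu : v ⬝ᵥ (((w u)⁻¹ • ∑ l, (u ^ d l) • S l) *ᵥ v) = 0 :=
      le_antisymm (by rw [← hzero] at hle; exact hle) (hform_nonneg u huI hu)
    have h := (hmono t₀ u ht₀ huI hu).dotProduct_mulVec_zero_iff v
    rw [star_trivial, Matrix.sub_mulVec, dotProduct_sub, hGv, dotProduct_zero, sub_zero] at h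
    have h2 := h.1 hformu
    rwa [sub_zero] at h2
  have hdet' : ∀ u, t₀ ≤ u → u ≤ s → (∑ l, (u ^ d l) • S l).det = 0 := by
    intro u hu hus
    have huI : u ∈ I := hIcc ⟨hu, hus⟩
    refine Matrix.exists_mulVec_eq_zero_iff.1 ⟨v, hv, ?_⟩
    have h := hGu u hu hus
    rw [Matrix.smul_mulVec] at h
    exact (smul_eq_zero.1 h).resolve_left (inv_ne_zero (hw u huI).ne')
  refine hdet (Polynomial.eq_zero_of_infinite_isRoot _ ((Set.Ioo_infinite hs).mono ?_))
  intro u hu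
  have hu' : t₀ < u ∧ u < s := hu
  show (Matrix.det (∑ l, ((Polynomial.X : Polynomial ℝ) ^ d l) •
      (S l).map Polynomial.C)).IsRoot u
  rw [Polynomial.IsRoot, ChainSector.eval_det_pencil d S u, hdet' u hu'.1.le hu'.2.le]

/-- **Root count on a window.**  `I ⊆ (0,∞)` order-connected, `w > 0` on `I`, `F/w` Loewner non-decreasing on `I`;
`π` a monotone map of `(0,∞)` into `I`; `ρ` a designated root region inside `I` whose points are fixed by `π` and stay
strictly below `π s` for every later `s`.  Then `det F` has at most `card ι` distinct roots in `ρ` (inertia chain for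
the clamped family `u ↦ (F/w)(π u)`). [folklore] -/
theorem posRoots_window_le (ι : Type) [Fintype ι] [DecidableEq ι] (d : Fin K → ℕ)
    (S : Fin K → Matrix ι ι ℝ) (hS : ∀ l, (S l).IsSymm) (w : ℝ → ℝ) (I : Set ℝ) (hI : I.OrdConnected)
    (hIpos : ∀ u ∈ I, 0 < u) (hw : ∀ u ∈ I, 0 < w u)
    (hmono : ∀ s t : ℝ, s ∈ I → t ∈ I → s ≤ t →
      (((w t)⁻¹ • ∑ l, (t ^ d l) • S l) - ((w s)⁻¹ • ∑ l, (s ^ d l) • S l)).PosSemidef)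
    (π : ℝ → ℝ) (hπ : Monotone π) (hπI : ∀ u, 0 < u → π u ∈ I)
    (ρ : ℝ → Prop) [DecidablePred ρ] (hρI : ∀ t, ρ t → t ∈ I)
    (hρπ : ∀ t s, ρ t → t < s → t < π s) (hπfix : ∀ t, ρ t → π t = t) :
    ((Matrix.det (∑ l, ((Polynomial.X : Polynomial ℝ) ^ d l) • (S l).map Polynomial.C)
        ).roots.toFinset.filter ρ).card ≤ Fintype.card ι := by
  set P := Matrix.det (∑ l, ((Polynomial.X : Polynomial ℝ) ^ d l) • (S l).map Polynomial.C)
    with hPdef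
  by_cases hdet : P = 0
  · simp [hdet]
  set R := P.roots.toFinset.filter ρ with hR
  let τ : Fin R.card ↪o ℝ := R.orderEmbOfFin rfl
  have hτmem : ∀ j, τ j ∈ R := fun j => R.orderEmbOfFin_mem rfl j
  have hτρ : ∀ j, ρ (τ j) := fun j => (Finset.mem_filter.1 (hτmem j)).2
  have hτI : ∀ j, τ j ∈ I := fun j => hρI _ (hτρ j)
  have hτpos : ∀ j, 0 < τ j := fun j => hIpos _ (hτI j)
  have hτroot : ∀ j, P.IsRoot (τ j) := fun j => by
    have h1 := (Finset.mem_filter.1 (hτmem j)).1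
    rw [Multiset.mem_toFinset] at h1
    exact (Polynomial.mem_roots hdet).1 h1
  let G : ℝ → Matrix ι ι ℝ := fun u => (w (π u))⁻¹ • ∑ l, ((π u) ^ d l) • S l
  have hdata : ∀ j, ∃ v : ι → ℝ, v ≠ 0 ∧ G (τ j) *ᵥ v = 0 ∧
      ∀ s : ℝ, τ j < s → 0 < v ⬝ᵥ (G s *ᵥ v) := by
    intro j
    obtain ⟨v, hv, hker, hpos⟩ :=
      kernelData_on d S w I hI hw hmono hdet (τ j) (hτI j) (hτroot j)
    refine ⟨v, hv, ?_, fun s hs => ?_⟩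
    · show ((w (π (τ j)))⁻¹ • ∑ l, ((π (τ j)) ^ d l) • S l) *ᵥ v = 0
      rw [hπfix _ (hτρ j)]
      exact hker
    · exact hpos (π s) (hπI s ((hτpos j).trans hs)) (hρπ _ _ (hτρ j) hs)
  choose v _hv0 hker hpos using hdata
  exact stub_inertiaChain ι G (fun u => LoewnerSector.smul_family_isSymm d S hS _ _)
    (fun s t hs hst => hmono (π s) (π t) (hπI s hs) (hπI t (hs.trans_le hst)) (hπ hst))
    R.card τ τ.strictMono hτpos v hker hpos

end RegimeWindows

/-- **TWO REGIME WINDOWS ⇒ `Z₊ ≤ 2·card ι`.**  Let `F = ∑ₗ X^{dₗ} Sₗ` have real symmetric `ι × ι` letters, and suppose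
that for some scale `x₁ > 0` and positive weights `w₁` (on `(0,x₁]`) and `w₂` (on `[x₁,∞)`) the family `F/w₁` is
Loewner non-INCREASING on `(0, x₁]` and `F/w₂` is Loewner non-DEcreasing on `[x₁, ∞)`.  Then `det F` has at most
`2·card ι` distinct positive zeros (`card ι` in `(0,x₁)` — left window applied to `−F` — plus `card ι` in `[x₁,∞)`).
[folklore] -/
theorem twoWindows_posRoots_le (ι : Type) [Fintype ι] [DecidableEq ι] {K : ℕ} (d : Fin K → ℕ)
    (S : Fin K → Matrix ι ι ℝ) (hS : ∀ l, (S l).IsSymm) (x₁ : ℝ) (hx₁ : 0 < x₁) (w₁ w₂ : ℝ → ℝ)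
    (hw₁ : ∀ u, 0 < u → u ≤ x₁ → 0 < w₁ u) (hw₂ : ∀ u, x₁ ≤ u → 0 < w₂ u)
    (hdown : ∀ s t : ℝ, 0 < s → s ≤ t → t ≤ x₁ →
      (((w₁ s)⁻¹ • ∑ l, (s ^ d l) • S l) - ((w₁ t)⁻¹ • ∑ l, (t ^ d l) • S l)).PosSemidef)
    (hup : ∀ s t : ℝ, x₁ ≤ s → s ≤ t →
      (((w₂ t)⁻¹ • ∑ l, (t ^ d l) • S l) - ((w₂ s)⁻¹ • ∑ l, (s ^ d l) • S l)).PosSemidef) :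
    ((Matrix.det (∑ l, ((Polynomial.X : Polynomial ℝ) ^ d l) • (S l).map Polynomial.C)
        ).roots.toFinset.filter (fun t => 0 < t)).card ≤ 2 * Fintype.card ι := by
  set P := Matrix.det (∑ l, ((Polynomial.X : Polynomial ℝ) ^ d l) • (S l).map Polynomial.C)
    with hPdef
  -- right window `[x₁, ∞)`
  have hright : (P.roots.toFinset.filter (fun t => x₁ ≤ t)).card ≤ Fintype.card ι :=
    RegimeWindows.posRoots_window_le ι d S hS w₂ (Set.Ici x₁) Set.ordConnected_Ici
      (fun u hu => hx₁.trans_le hu) (fun u hu => hw₂ u hu) (fun s t hs _ hst => hup s t hs hst)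
      (fun u => max u x₁) (fun a b hab => max_le_max hab le_rfl) (fun u _ => le_max_right u x₁)
      (fun t => x₁ ≤ t) (fun t ht => ht) (fun t s _ hts => lt_max_of_lt_left hts)
      (fun t ht => max_eq_left ht)
  -- left window: roots in `(0, x₁)`, monotonicity of `(−F)/w₁` on `(0, x₁]`
  have hleft : (P.roots.toFinset.filter (fun t => 0 < t ∧ t < x₁)).card ≤ Fintype.card ι := by
    have h := RegimeWindows.posRoots_window_le ι d (fun l => -S l) (fun l => (hS l).neg) w₁
      (Set.Ioc 0 x₁) Set.ordConnected_Ioc (fun u hu => hu.1) (fun u hu => hw₁ u hu.1 hu.2)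
      (fun s t hs ht hst => by
        rw [RegimeWindows.pencil_neg, RegimeWindows.pencil_neg, smul_neg, smul_neg, neg_sub_neg]
        exact hdown s t hs.1 hst ht.2)
      (fun u => min u x₁) (fun a b hab => min_le_min hab le_rfl)
      (fun u hu => ⟨lt_min hu hx₁, min_le_right u x₁⟩) (fun t => 0 < t ∧ t < x₁)
      (fun t ht => ⟨ht.1, ht.2.le⟩) (fun t s ht hts => lt_min hts ht.2) (fun t ht => min_eq_left ht.2.le)
    rwa [roots_det_pencil_neg d S] at h
  -- union bound
  have hsub : P.roots.toFinset.filter (fun t => 0 < t)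
      ⊆ P.roots.toFinset.filter (fun t => 0 < t ∧ t < x₁) ∪ P.roots.toFinset.filter (fun t => x₁ ≤ t) := by
    intro t ht
    rw [Finset.mem_filter] at ht
    rw [Finset.mem_union, Finset.mem_filter, Finset.mem_filter]
    rcases lt_or_ge t x₁ with h | h
    · exact Or.inl ⟨ht.1, ht.2, h⟩
    · exact Or.inr ⟨ht.1, h⟩
  calc (P.roots.toFinset.filter (fun t => 0 < t)).card
      ≤ (P.roots.toFinset.filter (fun t => 0 < t ∧ t < x₁)
          ∪ P.roots.toFinset.filter (fun t => x₁ ≤ t)).card := Finset.card_le_card hsub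
    _ ≤ (P.roots.toFinset.filter (fun t => 0 < t ∧ t < x₁)).card
          + (P.roots.toFinset.filter (fun t => x₁ ≤ t)).card := Finset.card_union_le _ _
    _ ≤ 2 * Fintype.card ι := by omega

end Summit.ValiantsHypothesis.ValiantsHypothesis.Theorems.LacunarySymmetroidMatrixDescartes
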